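import Summits.BirchSwinnertonDyer.Rank1Residual.X1.EisensteinSqueeze
import HarnessLib

/-!
# Route E, part 2 — the CONSTANT-TERM squeeze on the leaf X1 ∩ {r = 0}:
# `ord_p c₀(ϖ·L_p) ≤ b(E)` ⇒ Mazur's main conjecture, and `ord_p c₀ = b(E) + ord_p #Ш(E/ℚ)_an`

HONEST FRAMING (cell `b2b-bsdres`, run/shared/lean/b2b/bsd-rank1-residual/, verbatim in every
file): the goal of the cell is to DELETE the COMBINATION-SHAPED residual classes of the
Birch–Swinnerton-Dyer formula for ALL analytic-rank `≤ 1` elliptic curves over `ℚ` — "full BSD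
formula for every rank `≤ 1` curve in class `C`" assembled STRICTLY from published theorems — so
that the rank-`≤ 1` remainder becomes exactly the CONSTRUCTION-SHAPED classes, which are TYPED
(missing-input `Prop`s), NOT attempted. This is not "finishing BSD". Sub-cell
`b2b-bsdres-eisenstein-p1` (CLASS-OWNERS row "X1 (r=0)"), gen 11: research route; NO CLAIM BEYOND
STATED CLASSES; nothing here changes a label. NO definition; theorems over the PUBLISHED named
facts Wuthrich 2014 Thm. 16 (`hW16`), Greenberg 1999 Thm. 4.1 (`hGr`), modularity (`hmod`),
Gross–Zagier–Kolyvagin (`hGZK`), the tree's interpolation THEOREM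
`constantCoeff_padicLFunction_unitRoot` (Mazur–Tate–Teitelbaum (14.3)), and the typed per-pair datum
`AnalyticConstCoeffVal W p v` of part 1 (`X1/EisensteinSqueeze.lean`).

WHAT IS PROVED. Writing `ϖ·L_p = ι(f_E·h)` (Wuthrich Thm. 16) and
`b(E) := ord_p ∏ c_ℓ + 2·ord_p #Ẽ(𝔽_p) − 2·ord_p #E(ℚ)_tors`, Greenberg's Thm. 4.1 gives
`ord_p f_E(0) = b(E) + ord_p #Sel_{p^∞}(E/ℚ) ≥ b(E)` once `L(E,1) ≠ 0` (then `c₀ ≠ 0` by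
interpolation, so `Sel` is finite); hence `ord_p c₀ ≤ b(E)` forces `ord_p h(0) ≤ 0`, `h ∈ Λˣ`,
`char X = (ϖ·L_p)`: MAZUR'S MAIN CONJECTURE (§4 `mazurMainConjecture_of_constCoeffVal_le`), with NO
`λ_an`, NO `μ_an`, NO parity and NO lower bound on `λ_alg`; the Eisenstein case is `v = 1` with
`hb : 2·ord_p #E(ℚ)_tors < ord_p ∏ c_ℓ + 2·ord_p #Ẽ(𝔽_p)`. §5 states the TIER honestly, as a
theorem: `ord_p c₀ = b(E) + ord_p #Ш(E/ℚ)_an` (`analyticConstCoeffVal_of_shaAn`, from the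
interpolation formula, `ord_p(1 − α⁻¹) = ord_p #Ẽ(𝔽_p)` and `ϖ·[0]⁺_f = L(E,1)/Ω_E`), so
`ord_p c₀ ≤ b(E)` is EXACTLY `ord_p #Ш_an ≤ 0` — the constant-term squeeze is the `Λ`-side form of
x1b's lever `X1.bsdp_of_shaAn_unit…` (Wuthrich Prop. 21), obtained from Thm. 16 + Thm. 4.1 without
the BSD-formula detour, and EVERY Eisenstein route-N/route-E closure is a `p ∤ #Ш_an` pair. In
particular route E cannot fire on the cell's irreducible residue N1″ (`p ∣ #Ш_an` at every isogenous
curve; CLASS-CLOSURE-PLAN §3.8), which the gen-11 census attacks with routes P/T/D/N instead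
(X1R0-GAPMAP §20).

* §4 `mazurMainConjecture_of_constCoeffVal_le`, `mazurMainConjecture_of_constCoeffVal_one_of_hb`,
  `Leaf.bsdp_of_constCoeffVal_le`, `Leaf.bsdp_of_constCoeffVal_one_of_hb`,
  `Leaf.bsdp_of_constCoeffVal_one_of_dvd_tamagawaProduct`, `…_of_not_dvd_torsionOrder`.
* §5 `analyticConstCoeffVal_of_shaAn`, `Leaf.mazurMainConjecture_of_padicValRat_shaAn_le`.

References: [GreenbergLNM1716] Thm. 4.1 (p. 102), §5 p. 131; [Wuthrich2014] Thm. 16 (p. 397),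
Prop. 21 (p. 400); [MazurTateTeitelbaum1986Invent] §I.14 (14.3); [Miller2011LMS] §1;
HOME/b2b-bsdres-eisenstein-p1/X1R0-GAPMAP.md §20.
-/

noncomputable section

open scoped Classical MatrixGroups ModularForm

open PowerSeries CongruenceSubgroup WeierstrassCurve Literature.NumberTheory.EllipticCurves
  Literature.NumberTheory.EllipticCurves.ModularForms
  Literature.NumberTheory.EllipticCurves.Rank1Residual
  Literature.NumberTheory.EllipticCurves.Greenberg1999
  Summit.BirchSwinnertonDyer.BirchSwinnertonDyer.Theorems.Rank1ResidualX1Defs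
  Summit.BirchSwinnertonDyer.Rank1Residual.X1.MuLambda
  Summit.BirchSwinnertonDyer.Rank1Residual.X1.MuPart
  Summit.BirchSwinnertonDyer.Rank1Residual.X1.ParitySqueeze
  Summit.BirchSwinnertonDyer.Rank1Residual.X1.TamagawaSqueeze
  Summit.BirchSwinnertonDyer.Rank1Residual.X1.FactorSqueeze
  Summit.BirchSwinnertonDyer.Rank1Residual.X1.EisensteinSqueeze

set_option autoImplicit false

namespace Summit.BirchSwinnertonDyer.Rank1Residual.X1.ConstantTermSqueeze

/-! ## §4. The constant-term squeeze: `ord_p c₀ ≤ b(E)` ⇒ Mazur's main conjecture -/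

section ConstantTerm

variable {W : WeierstrassCurve ℚ} [W.IsElliptic] [W.IsGloballyMinimal] {p : ℕ} [Fact p.Prime]

/-- **The constant-term squeeze.** `W/ℚ` globally minimal elliptic with `L(E,1) ≠ 0`, `p ≠ 2` good
ordinary with `E[p]` reducible. Granted the PUBLISHED facts Wuthrich 2014 Thm. 16 (`hW16`:
`ϖ·L_p = ι(f_E·h)`, `h ∈ Λ`) and Greenberg 1999 Thm. 4.1 (`hGr`: `ord_p f_E(0) = ord_p ∏c_ℓ +
2·ord_p #Ẽ(𝔽_p)(p) + ord_p #Sel_{p^∞}(E/ℚ) − 2·ord_p #E(ℚ)(p)` when `Sel` is finite): if the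
constant term of `ϖ·L_p` has valuation `v` with
`v + 2·ord_p #E(ℚ)_tors ≤ ord_p ∏ c_ℓ + 2·ord_p #Ẽ(𝔽_p)` (i.e. `v ≤ b(E)`), then MAZUR'S MAIN
CONJECTURE holds at `(E,p)`: `c₀ = f_E(0)·h(0) ≠ 0` (interpolation + `L(E,1) ≠ 0`), so
`Sel_{p^∞}(E/ℚ)` is finite and `ord_p f_E(0) ≥ b(E) ≥ v = ord_p f_E(0) + ord_p h(0)`, whence
`h(0) ∈ ℤ_pˣ`, `h ∈ Λˣ`, `char X = (f_E) = (f_E·h)`. No `λ_an`, `μ_an`, parity or lower bound on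
`λ_alg` is used. [cite: GreenbergLNM1716, Thm. 4.1 (p. 102)] [cite: Wuthrich2014, Thm. 16 (p. 397)]
[cite: MazurTateTeitelbaum1986Invent, §I.14 (14.3)] -/
theorem mazurMainConjecture_of_constCoeffVal_le
    (hW16 : Wuthrich2014.charIdeal_dvd_padicLFunction) (hGr : greenberg_charValue_rankZero)
    (hp : p ≠ 2) (hgood : W.HasGoodReductionAtPrime p) (hord : ¬ (p : ℤ) ∣ W.frobeniusTrace p)
    (hred : ¬ W.HasIrreducibleModPGaloisRep p) (hL : W.entireLFunction 1 ≠ 0)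
    {v : ℤ} (hc : AnalyticConstCoeffVal W p v)
    (hb : v + 2 * (padicValNat p W.torsionOrder : ℤ) ≤
      (padicValNat p W.tamagawaProduct : ℤ) + 2 * (padicValNat p (W.reductionPointCount p) : ℤ)) :
    MazurMainConjecture W p := by
  intro κ γ hκ hγ hγ' _ f hf ϖ hϖ D
  have hpP : p.Prime := Fact.out
  have hordp : IsOrdinaryAt W p := ⟨hgood, hord⟩
  haveI : Module.Finite (IwasawaAlgebra p) D.X := D.module_finite_holds hγ
  -- Wuthrich Thm. 16: `X` torsion, `ι g = ϖ · L_p(f, α)` with `g ∈ char X = (fE)`, `g = fE · h`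
  obtain ⟨hX, g, hgmem, hιg⟩ := hW16 W p hp hordp hred hκ hγ hγ' hf D ϖ hϖ
  obtain ⟨fE, hchar⟩ := (charIdeal_isPrincipal_holds p D.X).principal
  have hchar' : D.charIdeal = Ideal.span {fE} := hchar
  have hgmem' : g ∈ Ideal.span {fE} := by rw [← hchar']; exact hgmem
  obtain ⟨h, hgh⟩ := Ideal.mem_span_singleton'.mp hgmem'
  have hfac : fE * h = g := by rw [mul_comm]; exact hgh
  have hιg' : iwasawaToPowerSeries p (fE * h) =
      C (ϖ : ℚ_[p]) * padicLFunction f (unitRoot W p : ℚ_[p]) := by rw [hfac, hιg]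
  have hg0 : fE * h ≠ 0 := mul_ne_zero_of_iota_eq hgood hord hf hϖ D hιg'
  have hfE0 : fE ≠ 0 := fun e ↦ hg0 (by rw [e, zero_mul])
  -- the typed datum on this factorisation: `ord_p (fE·h)(0) = v`
  have hval : ((constantCoeff (fE * h) : ℤ_[p]) : ℚ_[p]).valuation = v :=
    hc.valuation_constantCoeff_eq hf hϖ hιg'
  -- `c₀ ≠ 0`: the constant term of `ϖ · L_p` is `ϖ (1 - α⁻¹)² L(E,1)/Ω⁺_f ≠ 0`
  set a : ℚ_[p] := ((unitRoot W p : ℤ_[p]) : ℚ_[p]) with ha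
  set s : ℚ := ratPlusSymbol f 0 with hs_def
  have hs0 : s ≠ 0 := by
    intro h0
    apply hL
    rw [hf.entireLFunction_one_eq, ← hs_def, h0]
    simp
  have hϖ0 : ϖ ≠ 0 := varpi_ne_zero hf hϖ
  have hg0c : ((constantCoeff (fE * h) : ℤ_[p]) : ℚ_[p]) =
      (ϖ : ℚ_[p]) * ((1 - a⁻¹) ^ 2 * (s : ℚ_[p])) := by
    rw [← constantCoeff_iwasawaToPowerSeries p (fE * h), hιg', map_mul, constantCoeff_C,
      constantCoeff_padicLFunction_unitRoot hordp hf]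
  obtain ⟨u₂, hu₂⟩ := exists_unit_one_sub_unitRoot_inv p W hordp
  haveI : NeZero p := ⟨hpP.ne_zero⟩
  obtain ⟨u₃, hu₃⟩ := exists_unit_natCard_eq_mul_card_primaryComponent
    ((integralModelInt W).map (Int.castRingHom (ZMod p))).toAffine.Point p
  set Np : ℚ_[p] := (Nat.card (AddCommGroup.primaryComponent
    ((integralModelInt W).map (Int.castRingHom (ZMod p))).toAffine.Point p) : ℚ_[p]) with hNp
  have hNcount : (W.reductionPointCount p : ℚ_[p]) = ((u₃ : ℤ_[p]) : ℚ_[p]) * Np := by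
    rw [WeierstrassCurve.reductionPointCount, hNp]
    exact hu₃
  have hNp0 : Np ≠ 0 := by rw [hNp]; exact_mod_cast Nat.card_pos.ne'
  have h1 : (1 - a⁻¹) = ((u₂ : ℤ_[p]) : ℚ_[p]) * ((u₃ : ℤ_[p]) : ℚ_[p]) * Np := by
    rw [hu₂, hNcount, mul_assoc]
  have h1ne : (1 - a⁻¹) ≠ 0 := by
    rw [h1]
    exact mul_ne_zero (mul_ne_zero (coe_units_ne_zero p u₂) (coe_units_ne_zero p u₃)) hNp0
  have hgh00 : constantCoeff (fE * h) ≠ 0 := by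
    intro h0
    rw [h0, PadicInt.coe_zero] at hg0c
    have : (ϖ : ℚ_[p]) * ((1 - a⁻¹) ^ 2 * (s : ℚ_[p])) ≠ 0 :=
      mul_ne_zero (by exact_mod_cast hϖ0) (mul_ne_zero (pow_ne_zero 2 h1ne) (by exact_mod_cast hs0))
    exact this hg0c.symm
  have hfE00 : constantCoeff fE ≠ 0 := by
    intro h0; apply hgh00; rw [map_mul, h0, zero_mul]
  have hh00 : constantCoeff h ≠ 0 := by
    intro h0; apply hgh00; rw [map_mul, h0, mul_zero]
  -- `v = ord_p fE(0) + ord_p h(0)` with both summands `≥ 0`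
  set f0 : ℚ_[p] := ((constantCoeff fE : ℤ_[p]) : ℚ_[p]) with hf0
  set h0 : ℚ_[p] := ((constantCoeff h : ℤ_[p]) : ℚ_[p]) with hh0
  have hf0ne : f0 ≠ 0 := by rw [hf0]; exact PadicInt.coe_ne_zero.mpr hfE00
  have hh0ne : h0 ≠ 0 := by rw [hh0]; exact PadicInt.coe_ne_zero.mpr hh00
  have hsum : f0.valuation + h0.valuation = v := by
    rw [← hval, map_mul, PadicInt.coe_mul, Padic.valuation_mul hf0ne hh0ne]
  have hh0v : 0 ≤ h0.valuation := by
    rw [hh0]; exact PadicInt.valuation_coe_nonneg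
  -- `Sel_{p^∞}(E/ℚ)` is finite (since `fE(0) ≠ 0`), so Greenberg's Thm. 4.1 applies to `fE`
  have hSelfin : Finite (W.selmerGroupPInfty p) :=
    D.finite_selmerGroupPInfty_of_constantCoeff_ne_zero W hγ hX fE hchar' hfE00
  obtain ⟨hEfin, -⟩ := (W.finite_selmerGroupPInfty_iff p).mp hSelfin
  haveI := hEfin
  obtain ⟨u₁, hu₁⟩ := hGr W p hp hgood hord κ γ hκ hγ hγ' D hX fE hchar' hSelfin
  obtain ⟨u₄, hu₄⟩ := exists_unit_torsionOrder_eq W p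
  set vc := padicValNat p W.tamagawaProduct with hvc
  set Tp : ℚ_[p] := (Nat.card (AddCommGroup.primaryComponent W.toAffine.Point p) : ℚ_[p]) with hTp
  have hTp0 : Tp ≠ 0 := by rw [hTp]; exact_mod_cast Nat.card_pos.ne'
  have hp0 : (p : ℚ_[p]) ≠ 0 := Nat.cast_ne_zero.mpr hpP.ne_zero
  have hSel0 : (Nat.card (W.selmerGroupPInfty p) : ℚ_[p]) ≠ 0 := by
    haveI := hSelfin
    exact_mod_cast Nat.card_pos.ne'
  -- `#E(ℚ)_tors = u₄ · Tp` (up to the `DecidableEq ℚ` instance inside the group law)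
  have hu₄' : (W.torsionOrder : ℚ_[p]) = ((u₄ : ℤ_[p]) : ℚ_[p]) * Tp := by
    rw [hu₄, hTp]
    congr 1
    exact_mod_cast natCard_primaryComponent_point_congr W p _ _
  -- valuations in `f0 · Tp² = u₁ · p^vc · Np² · #Sel`
  have hval1 := congrArg Padic.valuation hu₁
  rw [Padic.valuation_mul hf0ne (pow_ne_zero 2 hTp0), Padic.valuation_pow,
    Padic.valuation_mul (mul_ne_zero (mul_ne_zero (coe_units_ne_zero p u₁) (pow_ne_zero vc hp0))
      (pow_ne_zero 2 hNp0)) hSel0,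
    Padic.valuation_mul (mul_ne_zero (coe_units_ne_zero p u₁) (pow_ne_zero vc hp0))
      (pow_ne_zero 2 hNp0),
    Padic.valuation_mul (coe_units_ne_zero p u₁) (pow_ne_zero vc hp0), valuation_coe_units_eq_zero,
    Padic.valuation_pow, Padic.valuation_pow, Padic.valuation_p] at hval1
  -- `v(Tp) = v(#E(ℚ)_tors)`, `v(Np) = v(#Ẽ(𝔽_p))`
  have hvT : Tp.valuation = (padicValNat p W.torsionOrder : ℤ) := by
    have e := congrArg Padic.valuation hu₄'
    rw [Padic.valuation_natCast, Padic.valuation_mul (coe_units_ne_zero p u₄) hTp0,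
      valuation_coe_units_eq_zero, zero_add] at e
    exact e.symm
  have hvN : Np.valuation = (padicValNat p (W.reductionPointCount p) : ℤ) := by
    have e := congrArg Padic.valuation hNcount
    rw [Padic.valuation_natCast, Padic.valuation_mul (coe_units_ne_zero p u₃) hNp0,
      valuation_coe_units_eq_zero, zero_add] at e
    exact e.symm
  rw [hvT, hvN] at hval1
  -- `v(#Sel) ≥ 0`
  have hSelv : 0 ≤ (Nat.card (W.selmerGroupPInfty p) : ℚ_[p]).valuation := by
    rw [Padic.valuation_natCast]; exact_mod_cast Nat.zero_le _
  simp only [Nat.cast_ofNat] at hval1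
  -- hence `ord_p h(0) = 0`: `h` is a unit of `Λ`
  have hh0zero : h0.valuation = 0 := by linarith
  have hunit : IsUnit h := isUnit_of_valuation_constantCoeff_eq_zero hh00 (by rw [← hh0]; exact hh0zero)
  refine ⟨hX, g, ?_, hιg⟩
  rw [hchar', ← hfac]
  exact ((span_eq_span_iff_isUnit hfE0 rfl).mpr hunit).symm

/-- **Route E (Eisenstein constant term): `ord_p c₀(ϖ·L_p) = 1` and
`hb : 2·ord_p #E(ℚ)_tors < ord_p ∏ c_ℓ + 2·ord_p #Ẽ(𝔽_p)` ⇒ Mazur's main conjecture** at a good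
ordinary Eisenstein pair with `L(E,1) ≠ 0` (the constant-term squeeze at `v = 1`).
[cite: GreenbergLNM1716, Thm. 4.1 (p. 102), §5 p. 131] [cite: Wuthrich2014, Thm. 16 (p. 397)] -/
theorem mazurMainConjecture_of_constCoeffVal_one_of_hb
    (hW16 : Wuthrich2014.charIdeal_dvd_padicLFunction) (hGr : greenberg_charValue_rankZero)
    (hp : p ≠ 2) (hgood : W.HasGoodReductionAtPrime p) (hord : ¬ (p : ℤ) ∣ W.frobeniusTrace p)
    (hred : ¬ W.HasIrreducibleModPGaloisRep p) (hL : W.entireLFunction 1 ≠ 0)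
    (hc : AnalyticConstCoeffVal W p 1)
    (hb : 2 * padicValNat p W.torsionOrder <
      padicValNat p W.tamagawaProduct + 2 * padicValNat p (W.reductionPointCount p)) :
    MazurMainConjecture W p :=
  mazurMainConjecture_of_constCoeffVal_le hW16 hGr hp hgood hord hred hL hc (by
    have hb' : 2 * (padicValNat p W.torsionOrder : ℤ) <
        (padicValNat p W.tamagawaProduct : ℤ) + 2 * (padicValNat p (W.reductionPointCount p) : ℤ) := by
      exact_mod_cast hb
    omega)

/-- **The constant-term squeeze on the leaf: `ord_p c₀(ϖ·L_p) = v ≤ b(E) ⇒ BSD(E,p)`** (through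
`RankZero.Leaf.mazurMainConjecture_iff_bsdp`; `L(E,1) ≠ 0` from `r_an = 0` by modularity).
[cite: GreenbergLNM1716, Thm. 4.1 (p. 102)] [cite: Wuthrich2014, Thm. 16 (p. 397)] -/
theorem Leaf.bsdp_of_constCoeffVal_le
    (hW16 : Wuthrich2014.charIdeal_dvd_padicLFunction) (hGr : greenberg_charValue_rankZero)
    (hmod : nonempty_modularParametrizationData)
    (hGZK : rank_eq_analyticRank_of_analyticRank_le_one) (hL : RankZero.Leaf W p)
    {v : ℤ} (hc : AnalyticConstCoeffVal W p v)
    (hb : v + 2 * (padicValNat p W.torsionOrder : ℤ) ≤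
      (padicValNat p W.tamagawaProduct : ℤ) + 2 * (padicValNat p (W.reductionPointCount p) : ℤ)) :
    BSDp W p :=
  have hX := isClassX1_of_classX1 hL.classX1
  (RankZero.Leaf.mazurMainConjecture_iff_bsdp hW16 hGr hmod hGZK hL).mp
    (mazurMainConjecture_of_constCoeffVal_le hW16 hGr hX.two_ne hX.hasGoodReductionAtPrime
      hX.not_dvd_frobeniusTrace hX.not_hasIrreducibleModPGaloisRep
      (entireLFunction_one_ne_zero_of_analyticRank_eq_zero hmod W hL.analyticRank_eq_zero) hc hb)

/-- **Route E on the leaf: Eisenstein constant term (`ord_p c₀ = 1`) and `hb` ⇒ `BSD(E,p)`.**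
[cite: GreenbergLNM1716, Thm. 4.1 (p. 102), §5 p. 131] [cite: Wuthrich2014, Thm. 16 (p. 397)] -/
theorem Leaf.bsdp_of_constCoeffVal_one_of_hb
    (hW16 : Wuthrich2014.charIdeal_dvd_padicLFunction) (hGr : greenberg_charValue_rankZero)
    (hmod : nonempty_modularParametrizationData)
    (hGZK : rank_eq_analyticRank_of_analyticRank_le_one) (hL : RankZero.Leaf W p)
    (hc : AnalyticConstCoeffVal W p 1)
    (hb : 2 * padicValNat p W.torsionOrder <
      padicValNat p W.tamagawaProduct + 2 * padicValNat p (W.reductionPointCount p)) :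
    BSDp W p :=
  Leaf.bsdp_of_constCoeffVal_le hW16 hGr hmod hGZK hL hc (by
    have hb' : 2 * (padicValNat p W.torsionOrder : ℤ) <
        (padicValNat p W.tamagawaProduct : ℤ) + 2 * (padicValNat p (W.reductionPointCount p) : ℤ) := by
      exact_mod_cast hb
    omega)

/-- **Route E on the leaf, `p ∣ ∏ c_ℓ` and `p² ∤ #E(ℚ)_tors`: `ord_p c₀ = 1 ⇒ BSD(E,p)`** (`hb` from
the anomalous prime: `ord_p #Ẽ(𝔽_p) ≥ 1`, `ParitySqueeze.Leaf.one_le_padicValNat_reductionPointCount`).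
[cite: GreenbergLNM1716, Thm. 4.1 (p. 102), §5 p. 131] [cite: Wuthrich2014, Thm. 16 (p. 397)] -/
theorem Leaf.bsdp_of_constCoeffVal_one_of_dvd_tamagawaProduct
    (hW16 : Wuthrich2014.charIdeal_dvd_padicLFunction) (hGr : greenberg_charValue_rankZero)
    (hmod : nonempty_modularParametrizationData)
    (hGZK : rank_eq_analyticRank_of_analyticRank_le_one) (hL : RankZero.Leaf W p)
    (htors : ¬ p ^ 2 ∣ W.torsionOrder) (htam : p ∣ W.tamagawaProduct)
    (hc : AnalyticConstCoeffVal W p 1) : BSDp W p := by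
  refine Leaf.bsdp_of_constCoeffVal_one_of_hb hW16 hGr hmod hGZK hL hc ?_
  have h1 := ParitySqueeze.Leaf.one_le_padicValNat_reductionPointCount hL
  have htam0 : W.tamagawaProduct ≠ 0 := (W.tamagawaProduct_pos').ne'
  have h2 : 1 ≤ padicValNat p W.tamagawaProduct := one_le_padicValNat_of_dvd htam0 htam
  have h3 : padicValNat p W.torsionOrder ≤ 1 := by
    by_contra hlt
    push Not at hlt
    exact htors ((padicValNat_dvd_iff_le (W.torsionOrder_pos_holds).ne').mpr hlt)
  omega

/-- **Route E on the leaf, `p ∤ #E(ℚ)_tors`: `ord_p c₀ = 1 ⇒ BSD(E,p)`** (`hb` automatic: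
`2·ord_p #Ẽ(𝔽_p) ≥ 2`). [cite: GreenbergLNM1716, Thm. 4.1 (p. 102), §5 p. 131]
[cite: Wuthrich2014, Thm. 16 (p. 397)] -/
theorem Leaf.bsdp_of_constCoeffVal_one_of_not_dvd_torsionOrder
    (hW16 : Wuthrich2014.charIdeal_dvd_padicLFunction) (hGr : greenberg_charValue_rankZero)
    (hmod : nonempty_modularParametrizationData)
    (hGZK : rank_eq_analyticRank_of_analyticRank_le_one) (hL : RankZero.Leaf W p)
    (htors : ¬ p ∣ W.torsionOrder) (hc : AnalyticConstCoeffVal W p 1) : BSDp W p := by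
  refine Leaf.bsdp_of_constCoeffVal_one_of_hb hW16 hGr hmod hGZK hL hc ?_
  have h0 : padicValNat p W.torsionOrder = 0 := padicValNat.eq_zero_of_not_dvd htors
  have h1 := ParitySqueeze.Leaf.one_le_padicValNat_reductionPointCount hL
  omega

end ConstantTerm

/-! ## §5. The link with `#Ш_an`: `ord_p c₀ = b(E) + ord_p #Ш(E/ℚ)_an` (tier honesty) -/

section Link

variable {W : WeierstrassCurve ℚ} [W.IsElliptic] [W.IsGloballyMinimal] {p : ℕ} [Fact p.Prime]

/-- **`ord_p c₀(ϖ·L_p) = 2·ord_p #Ẽ(𝔽_p) + ord_p ∏ c_ℓ − 2·ord_p #E(ℚ)_tors + ord_p #Ш(E/ℚ)_an`** at a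
good ordinary prime when `L(E,1) ≠ 0` and `#Ш(E/ℚ)_an = s ∈ ℚ` (`shaAn W = s`). PROOF (all tree
theorems): `c₀ = ϖ (1 − α⁻¹)² [0]⁺_f` (Mazur–Tate–Teitelbaum interpolation,
`constantCoeff_padicLFunction_unitRoot`), `1 − α⁻¹ = u · #Ẽ(𝔽_p)` (`exists_unit_one_sub_unitRoot_inv`),
`ϖ · [0]⁺_f = L(E,1)/Ω_E` (`IsNewformOf.entireLFunction_one_eq`, `ϖ·Ω_E = Ω⁺_f`) and
`#Ш_an = (L(E,1)/Ω_E)·#E(ℚ)²/∏ c_ℓ` (`shaAn_eq_of_L_one_div_eq`, rank `0` by Gross–Zagier–Kolyvagin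
`hGZK`). CONSEQUENCE for the tier of route E: the typed datum `AnalyticConstCoeffVal W p v` is the
integer `b(E) + ord_p #Ш_an` (`b(E) = ord_p ∏c + 2 ord_p #Ẽ − 2 ord_p #tors`), so the hypothesis
`v ≤ b(E)` of `mazurMainConjecture_of_constCoeffVal_le` is exactly `ord_p #Ш(E/ℚ)_an ≤ 0` (x1b's
lever, Wuthrich Prop. 21), and the Eisenstein case `v = 1` with `b(E) ≥ 1` is `p ∤ #Ш_an ∧ b(E) = 1`.
[cite: MazurTateTeitelbaum1986Invent, §I.14 (14.3)] [cite: Miller2011LMS, §1 (arXiv:1010.2431 p. 3)] -/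
theorem analyticConstCoeffVal_of_shaAn (hGZK : rank_eq_analyticRank_of_analyticRank_le_one)
    (hgood : W.HasGoodReductionAtPrime p) (hord : ¬ (p : ℤ) ∣ W.frobeniusTrace p)
    (hL : W.entireLFunction 1 ≠ 0) {s : ℚ} (hs : shaAn W = (s : ℂ)) :
    AnalyticConstCoeffVal W p
      (2 * (padicValNat p (W.reductionPointCount p) : ℤ) + (padicValNat p W.tamagawaProduct : ℤ) -
        2 * (padicValNat p W.torsionOrder : ℤ) + padicValRat p s) := by
  intro _ f hf ϖ hϖ
  have hpP : p.Prime := Fact.out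
  have hordp : IsOrdinaryAt W p := ⟨hgood, hord⟩
  rw [constantCoeff_padicLFunction_unitRoot hordp hf]
  set a : ℚ_[p] := ((unitRoot W p : ℤ_[p]) : ℚ_[p]) with ha
  set r : ℚ := ratPlusSymbol f 0 with hr_def
  -- `q := ϖ·[0]⁺_f = L(E,1)/Ω_E`
  have hΩ : (W.realPeriodRat : ℂ) ≠ 0 := by exact_mod_cast W.realPeriodRat_pos_holds.ne'
  have hL1 : W.entireLFunction 1 = (((ϖ * r : ℚ) : ℝ) : ℂ) * (W.realPeriodRat : ℂ) := by
    rw [hf.entireLFunction_one_eq, ← hr_def, ← hϖ]; push_cast; ring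
  have hq : W.entireLFunction 1 / (W.realPeriodRat : ℂ) = ((ϖ * r : ℚ) : ℂ) := by
    rw [hL1, mul_div_cancel_right₀ _ hΩ]; push_cast; rfl
  obtain ⟨-, hE, -, hsha⟩ := Wuthrich2014.shaAn_eq_of_L_one_div_eq hGZK W hL hq
  haveI := hE
  have hq0 : ϖ * r ≠ 0 := by
    intro h0
    apply hL
    rw [hL1, h0]; push_cast; ring
  have hcard0 : (Nat.card W.toAffine.Point : ℚ) ≠ 0 := by
    exact_mod_cast (Nat.card_pos (α := W.toAffine.Point)).ne'
  have htam0 : (W.tamagawaProduct : ℚ) ≠ 0 := by exact_mod_cast (W.tamagawaProduct_pos').ne'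
  -- `s = q · #E(ℚ)² / ∏ c_ℓ`
  have hs' : s = ϖ * r * (Nat.card W.toAffine.Point : ℚ) ^ 2 / (W.tamagawaProduct : ℚ) := by
    have e := hs.symm.trans hsha
    exact_mod_cast e
  have hs0 : s ≠ 0 := by
    rw [hs']; exact div_ne_zero (mul_ne_zero hq0 (pow_ne_zero 2 hcard0)) htam0
  have hqs : ϖ * r = s * (W.tamagawaProduct : ℚ) / (Nat.card W.toAffine.Point : ℚ) ^ 2 := by
    rw [hs']; field_simp
  -- valuation of `q`
  have hvq : padicValRat p (ϖ * r) = padicValRat p s + (padicValNat p W.tamagawaProduct : ℤ) -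
      2 * (padicValNat p W.torsionOrder : ℤ) := by
    rw [hqs, padicValRat.div (mul_ne_zero hs0 htam0) (pow_ne_zero 2 hcard0),
      padicValRat.mul hs0 htam0, padicValRat.pow, padicValRat.of_nat,
      W.torsionOrder_eq_natCard_of_finite, padicValRat.of_nat]
    push_cast; ring
  -- valuation of `(1 - α⁻¹)²`
  obtain ⟨u₂, hu₂⟩ := exists_unit_one_sub_unitRoot_inv p W hordp
  have hN0 : (W.reductionPointCount p : ℚ_[p]) ≠ 0 := by
    exact_mod_cast (W.reductionPointCount_pos p).ne'
  have h1ne : (1 - a⁻¹) ≠ 0 := by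
    rw [hu₂]; exact mul_ne_zero (coe_units_ne_zero p u₂) hN0
  have hv1 : (1 - a⁻¹).valuation = (padicValNat p (W.reductionPointCount p) : ℤ) := by
    rw [hu₂, Padic.valuation_mul (coe_units_ne_zero p u₂) hN0, valuation_coe_units_eq_zero,
      Padic.valuation_natCast, zero_add]
  -- assemble
  have hqp0 : (((ϖ * r : ℚ)) : ℚ_[p]) ≠ 0 := by exact_mod_cast hq0
  have hrew : (ϖ : ℚ_[p]) * ((1 - a⁻¹) ^ 2 * ((r : ℚ) : ℚ_[p])) =
      (1 - a⁻¹) ^ 2 * (((ϖ * r : ℚ)) : ℚ_[p]) := by push_cast; ring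
  rw [hrew, Padic.valuation_mul (pow_ne_zero 2 h1ne) hqp0, Padic.valuation_pow, hv1,
    Padic.valuation_ratCast, hvq]
  push_cast; ring

/-- **The constant-term squeeze IS the `p ∤ #Ш_an` lever, Λ-side** (honesty theorem): on the leaf,
`#Ш(E/ℚ)_an = s` with `ord_p s ≤ 0` ⇒ Mazur's main conjecture — from Wuthrich Thm. 16 + Greenberg
Thm. 4.1 + the interpolation formula, without the BSD-formula detour of
`Rank1ResidualX1Converse.mazurMainConjecture_iff_bsdp`. (x1b's `X1.bsdp_of_shaAn_unit…` gives
`BSD(E,p)` from Wuthrich Prop. 21 on the same datum.) [cite: GreenbergLNM1716, Thm. 4.1 (p. 102)]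
[cite: Wuthrich2014, Thm. 16 (p. 397), Prop. 21 (p. 400)] -/
theorem Leaf.mazurMainConjecture_of_padicValRat_shaAn_le
    (hW16 : Wuthrich2014.charIdeal_dvd_padicLFunction) (hGr : greenberg_charValue_rankZero)
    (hmod : nonempty_modularParametrizationData)
    (hGZK : rank_eq_analyticRank_of_analyticRank_le_one) (hL : RankZero.Leaf W p)
    {s : ℚ} (hs : shaAn W = (s : ℂ)) (hs0 : padicValRat p s ≤ 0) : MazurMainConjecture W p := by
  have hX := isClassX1_of_classX1 hL.classX1
  have hL1 : W.entireLFunction 1 ≠ 0 :=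
    entireLFunction_one_ne_zero_of_analyticRank_eq_zero hmod W hL.analyticRank_eq_zero
  refine mazurMainConjecture_of_constCoeffVal_le hW16 hGr hX.two_ne hX.hasGoodReductionAtPrime
    hX.not_dvd_frobeniusTrace hX.not_hasIrreducibleModPGaloisRep hL1
    (analyticConstCoeffVal_of_shaAn hGZK hX.hasGoodReductionAtPrime hX.not_dvd_frobeniusTrace hL1 hs)
    ?_
  omega

end Link


end Summit.BirchSwinnertonDyer.Rank1Residual.X1.ConstantTermSqueeze

end
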